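import Summits.CriticalPhenomena.PercolationContinuityZ3.Theorems.PercNearOneGluingNoHeavyLowerTailSahiGridPatternZDecomp

/-!
# `NoHeavyLowerTail` (crux stmt-CriticalPhenomena-4575), Sahi programme: **FIBRE KLEITMAN ON `[3]^n`** — the Latin count is dominated by
# the totally-distinct pair count, every dimension

Support file (seat `prim-ineq-gen-4`, generation 11; `--supports stmt-CriticalPhenomena-4575`).  Pure proofs, no definitions, no `sorry`,
standard axioms.  Vocabulary of `…SahiGridPattern{SliceForm,ZDecomp,ZProfile}` (`TotDist`, `thirdPt`, the Boolean-cube chart `fromSet`/`fam`,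
`card_inter_compls_le`) and `SahiGrid3.ind`.

THE MATHEMATICS.  For up-sets `V, W ⊆ [3]^n` and ANY point `p`, among the `2^n` points `q` totally distinct from `p` (a Boolean cube on which
`q ↦ thirdPt p q` is the antipodal map):
  `#{q : q ∈ V, thirdPt p q ∈ W} ≤ #{q : q ∈ V ∩ W}`                                   (`sum_fibre_third_le`)
(Harris–Kleitman twice on the cube around `p`: the tree's `card_inter_compls_le` through the chart `fromSet p`).  Summing over `p ∈ U`:
  `Lat(U;V,W) := #{(p,q) : p ∈ U, q ∈ V, p δ̸ q, thirdPt p q ∈ W} ≤ N(U, V ∩ W) := #{(p,q) : p ∈ U, q ∈ V ∩ W, p δ̸ q}`   (`sum_ind_lat_le_td`)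
for every `U` (indicator form, all `n`).  This is the 'fibre Kleitman' inequality used throughout the top-slice-dominance memo
(`run/shared/lean/prim/prim-ineq-gen-4/FINDING-TOP-SLICE-DOMINANCE-g11.md` §2, §2c) and in the gen-10 lifting lemmas. [this work]
-/

namespace Summit.CriticalPhenomena.PercolationContinuityZ3.Theorems.SahiGridPattern

open Finset SahiGrid3
open scoped BigOperators FinsetFamily

variable {n : ℕ}

/-- `thirdPt` is symmetric. [this work] -/
theorem thirdPt_comm (p q : Pd n) : thirdPt p q = thirdPt q p := by
  funext a; unfold thirdPt; rw [add_comm]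

/-- Indicator of an intersection. [this work] -/
theorem ind_inter_eq_mul {Y : Type*} [DecidableEq Y] (S T : Finset Y) (y : Y) : ind (S ∩ T) y = ind S y * ind T y := by
  unfold ind
  by_cases hS : y ∈ S <;> by_cases hT : y ∈ T <;> simp [hS, hT]

/-- `TotDist` is symmetric (Boolean form). [this work] -/
theorem totDist_symm (p q : Pd n) : TotDist p q = TotDist q p := by
  rw [Bool.eq_iff_iff, totDist_iff, totDist_iff]
  exact ⟨fun h a => (h a).symm, fun h a => (h a).symm⟩

/-- Cardinality of a family as an indicator sum over all subsets. [this work] -/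
theorem card_eq_sum_ite_mem (X : Finset (Finset (Fin n))) : (X.card : ℤ) = ∑ T, if T ∈ X then (1 : ℤ) else 0 := by
  rw [Finset.sum_boole, Finset.filter_mem_eq_inter, Finset.univ_inter]

/-- `ind` is nonnegative. [this work] -/
theorem ind_nonneg' {Y : Type*} [DecidableEq Y] (S : Finset Y) (y : Y) : 0 ≤ ind S y := by
  unfold ind; split_ifs <;> norm_num

/-- **Fibre Kleitman** (every `n`): for up-sets `V, W` and any point `p`,
`Σ_{q δ̸ p} 1_V(q) 1_W(thirdPt q p) ≤ Σ_{q δ̸ p} 1_V(q) 1_W(q)`. [this work] -/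
theorem sum_fibre_third_le {V W : Finset (Pd n)} (hV : IsUpperSet (V : Set (Pd n))) (hW : IsUpperSet (W : Set (Pd n))) (p : Pd n) :
    (∑ q, (if TotDist q p = true then (1 : ℤ) else 0) * (ind V q * ind W (thirdPt q p))) ≤
      ∑ q, (if TotDist q p = true then (1 : ℤ) else 0) * (ind V q * ind W q) := by
  have hl : (∑ q, (if TotDist q p = true then (1 : ℤ) else 0) * (ind V q * ind W (thirdPt q p))) =
      ∑ q ∈ univ.filter (fun x : Pd n => TotDist x p = true), ind V q * ind W (thirdPt q p) := by
    rw [Finset.sum_filter]; refine Finset.sum_congr rfl fun q _ => ?_; split_ifs <;> simp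
  have hr : (∑ q, (if TotDist q p = true then (1 : ℤ) else 0) * (ind V q * ind W q)) =
      ∑ q ∈ univ.filter (fun x : Pd n => TotDist x p = true), ind V q * ind W q := by
    rw [Finset.sum_filter]; refine Finset.sum_congr rfl fun q _ => ?_; split_ifs <;> simp
  rw [hl, hr, sum_totDist_eq_sum_sets, sum_totDist_eq_sum_sets]
  have e1 : (∑ T : Finset (Fin n), ind V (fromSet p T) * ind W (thirdPt (fromSet p T) p)) =
      (((fam p V) ∩ (fam p W)ᶜˢ).card : ℤ) := by
    rw [card_eq_sum_ite_mem]
    refine Finset.sum_congr rfl fun T _ => ?_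
    rw [thirdPt_fromSet]
    unfold ind
    by_cases h1 : fromSet p T ∈ V <;> by_cases h2 : fromSet p Tᶜ ∈ W <;>
      simp [h1, h2, mem_inter, mem_fam, Finset.mem_compls]
  have e2 : (∑ T : Finset (Fin n), ind V (fromSet p T) * ind W (fromSet p T)) = (((fam p V) ∩ (fam p W)).card : ℤ) := by
    rw [card_eq_sum_ite_mem]
    refine Finset.sum_congr rfl fun T _ => ?_
    unfold ind
    by_cases h1 : fromSet p T ∈ V <;> by_cases h2 : fromSet p T ∈ W <;> simp [h1, h2, mem_inter, mem_fam]
  rw [e1, e2]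
  exact_mod_cast card_inter_compls_le (isUpperSet_fam p hV) (isUpperSet_fam p hW)

/-- **Fibre Kleitman, summed** (every `n`): for any `U` and up-sets `V, W`,
`Σ_{p,q} 1_U(p) 1_V(q) 1_W(p̄q) [p δ̸ q] ≤ Σ_{p,q} 1_U(p) 1_V(q) 1_W(q) [p δ̸ q]` — the number of Latin lines with first point in `U`, second in `V`,
third in `W` is at most the number of totally distinct pairs `U × (V ∩ W)`. [this work] -/
theorem sum_ind_lat_le_td (U : Finset (Pd n)) {V W : Finset (Pd n)} (hV : IsUpperSet (V : Set (Pd n))) (hW : IsUpperSet (W : Set (Pd n))) :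
    (∑ p, ∑ q, ind U p * ind V q * ind W (thirdPt p q) * (if TotDist p q = true then (1 : ℤ) else 0)) ≤
      ∑ p, ∑ q, ind U p * ind V q * ind W q * (if TotDist p q = true then (1 : ℤ) else 0) := by
  refine Finset.sum_le_sum fun p _ => ?_
  have key := sum_fibre_third_le hV hW p
  have hp := ind_nonneg' U p
  have el : (∑ q, ind U p * ind V q * ind W (thirdPt p q) * (if TotDist p q = true then (1 : ℤ) else 0)) =
      ind U p * ∑ q, (if TotDist q p = true then (1 : ℤ) else 0) * (ind V q * ind W (thirdPt q p)) := by
    rw [Finset.mul_sum]; refine Finset.sum_congr rfl fun q _ => ?_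
    rw [thirdPt_comm p q, totDist_symm p q]; ring
  have er : (∑ q, ind U p * ind V q * ind W q * (if TotDist p q = true then (1 : ℤ) else 0)) =
      ind U p * ∑ q, (if TotDist q p = true then (1 : ℤ) else 0) * (ind V q * ind W q) := by
    rw [Finset.mul_sum]; refine Finset.sum_congr rfl fun q _ => ?_
    rw [totDist_symm p q]; ring
  rw [el, er]
  exact mul_le_mul_of_nonneg_left key hp

end Summit.CriticalPhenomena.PercolationContinuityZ3.Theorems.SahiGridPattern
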